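import Summits.ABC.ABC.Theorems.TameLocalReceptacle.Negative.TameLocalReceptacleFalseOfMatchingHypothesis
import Literature.NumberTheory.LFunctions.RHWave0

/-!
# Sketch — crux idea `grh-friable-cell-resolution` (crux stmt-ABC-14354 `TameLocalReceptacle`, round 2, ideator 5)

First lemma of the line (signatures elaborate; proofs are NOT claimed):

* `friableCharSum`, `friableCount` — `Ψ(t, y; χ)` and `Ψ(t, y)`;
* `FriablePowerSaving` — the LOAD-BEARING analytic input in its weakest natural form: a POWER-OF-`y`
  saving for character sums over `y`-friable integers, for all non-trivial characters of conductor
  `≤ y^C`, in the regime `x = y^u`, `u ≥ u₀(C)` fixed;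
* `friablePowerSaving_of_grh` — GRH supplies it (Lagarias–Soundararajan, PLMS 104 (2012) Prop. 5.1:
  `|L(s, χ; y)| ≪ (q|s|)^ε` on `Re s ≥ 1/2 + ε` under GRH, then Perron; a zero-free half-plane
  `Re s > σ₀` for any `σ₀ < 1` suffices with `u₀ = O(C/(1-σ₀))`);
* `matchingHypothesis_of_friablePowerSaving` — the circle-method step: key-cell asymptotics for the
  five `y`-friable box families of `MatchingFamilies (1/4)` (major arcs from `FriablePowerSaving`,
  minor arcs from Harper 2016 Thm 1, fractional moments from Harper 2016 Thm 2), then bookkeeping;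
* `not_tameLocalReceptacle_of_grh` — composition with the LANDED negative lemma
  `TameLocalReceptacle_false_of_MatchingHypothesis` (p121503).
-/

set_option linter.dupNamespace false

namespace Summit.ABC.ABC.Cruxes.TameLocalReceptacle.GRHCellResolution

open Finset
open Summit.ABC.ABC.Theses.CongruentialReceptacle
open Summit.ABC.ABC.Theorems.TameLocalReceptacle
open Literature.NumberTheory.LFunctions

/-- `Ψ(t, y; χ) = Σ_{n ≤ t, P⁺(n) ≤ y} χ(n)` for a Dirichlet character `χ` mod `q`. -/
noncomputable def friableCharSum (t y q : ℕ) (χ : DirichletCharacter ℂ q) : ℂ :=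
  ∑ n ∈ (Icc 1 t).filter (· ∈ Nat.smoothNumbers (y + 1)), χ (n : ZMod q)

/-- `Ψ(t, y) = #{n ≤ t : P⁺(n) ≤ y}`. -/
def friableCount (t y : ℕ) : ℕ := ((Icc 1 t).filter (· ∈ Nat.smoothNumbers (y + 1))).card

/-- **FriablePowerSaving** — the minimal analytic input of the line, typed.  For every `C > 0` there is
`u₀` such that in the regime `y^u ≤ x ≤ y^{u+1}`, `u ≥ u₀` fixed, for all large `y`, all
`√x ≤ t ≤ x`, all moduli `1 < q ≤ y^C` and all non-trivial characters `χ` mod `q`: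
`|Ψ(t, y; χ)| ≤ Ψ(t, y) · y^{-C}`.  Implied by GRH (`friablePowerSaving_of_grh`); unconditionally out of
reach (the saving in print is `e^{-cu/log²(u+1)} + y^{-c}` with a small absolute `c`, Harper 2012,
arXiv:1208.5992 Thms 1–3), which is exactly why line `SketchIdeator1` died. -/
def FriablePowerSaving : Prop :=
  ∀ C : ℝ, 0 < C → ∃ u₀ : ℝ, 0 < u₀ ∧ ∀ u : ℝ, u₀ ≤ u → ∃ y₀ : ℕ, ∀ y x t q : ℕ,
    y₀ ≤ y → (y : ℝ) ^ u ≤ (x : ℝ) → (x : ℝ) ≤ (y : ℝ) ^ (u + 1) → Nat.sqrt x ≤ t → t ≤ x →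
    1 < q → (q : ℝ) ≤ (y : ℝ) ^ C → ∀ χ : DirichletCharacter ℂ q, χ ≠ 1 →
      ‖friableCharSum t y q χ‖ ≤ (friableCount t y : ℝ) * (y : ℝ) ^ (-C)

/-- FIRST STUB (conditional literature fact): GRH ⟹ `FriablePowerSaving`.
[cite: LagariasSoundararajan2012, Prop. 5.1 (GRH-Lindelöf for partial Euler products `L(s,χ;y)`)]
Proof sketch: Perron on `Re s = 1/2 + ε` gives `|Ψ(t,y;χ)| ≪ t^{1/2+2ε} q^ε`, while
`Ψ(t, y) = t^{α(t,y)+o(1)}` with `α → 1` as `y → ∞` at fixed `u` (Hildebrand–Tenenbaum); take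
`u₀ = 2(C + 2)/(1 - 4ε)`. -/
theorem friablePowerSaving_of_grh : GeneralizedRiemannHypothesis → FriablePowerSaving := by
  sorry

/-- SECOND STUB (the circle-method step, research-level ADAPTATION of printed tools):
`FriablePowerSaving ⟹ MatchingFamilies (1/4)`.  Witnesses: `y`-friable box families at scale
`X = y^u` (`u ≥ u₀(7)` fixed), special members `2^N·m` with `2^N ≍ y^{3/2}`, generic families `G`
(scale `X`) and `G'` (scale `X/2^N`).  Key cells at a data prime `q₀ ≤ y^{1-o(1)}` are congruence
conditions to moduli `q₀^{v+1}` (member) and `q₀` (partner); major arcs `q(1+|ηX|) ≤ P' ≍ q₀³`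
need friables in progressions to moduli `≤ P'·q₀² ≤ y^{5+o(1)}` with RELATIVE error `≤ y^{-7/2}`
(`FriablePowerSaving` with `C = 7`), minor arcs use Harper 2016 Thm 1 (`Ψ·(q(1+|δx|))^{-1/2+3(1-α)/2}`)
and Harper 2016 Thm 2 (restriction, `∫|S|^{2.1} ≪ Ψ^{2.1}/x`); main terms of the nine comparisons agree
cell by cell up to `O(1/u)` absolute. -/
theorem matchingHypothesis_of_friablePowerSaving : FriablePowerSaving → MatchingHypothesis := by
  sorry

/-- COMPOSITION with the landed negative lemma (p121503): under GRH the crux is false. -/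
theorem not_tameLocalReceptacle_of_grh (h : GeneralizedRiemannHypothesis) : ¬ TameLocalReceptacle :=
  TameLocalReceptacle_false_of_MatchingHypothesis
    (matchingHypothesis_of_friablePowerSaving (friablePowerSaving_of_grh h))

/-- Contrapositive, the form worth quoting to the route's tenure: the crux implies the failure of GRH. -/
theorem not_grh_of_tameLocalReceptacle (h : TameLocalReceptacle) : ¬ GeneralizedRiemannHypothesis :=
  fun hG => not_tameLocalReceptacle_of_grh hG h

end Summit.ABC.ABC.Cruxes.TameLocalReceptacle.GRHCellResolution
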